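import Literature.IUT.HodgeTheaters.StableCurveTemperedDataOfSpecialFibreTowerKernel
import Literature.IUT.HodgeTheaters.StableCurveTemperedDataOfSpecialFibrePiDataProp24ii
import Literature.IUT.HodgeTheaters.StableCurveTemperedDataOfSpecialFibreLevelData
import HarnessLib

/-!
# [IUTchI] Prop. 2.4 (i) at the genuine 𝔛-datum: the inverse-limit input (INV) `DetectsTempered` DISCHARGED
# modulo "the admissible kernels shrink to `1`", from [SemiAnbd] Def. 3.1 (i) (`IsTempered`)

Mochizuki, *Inter-universal Teichmüller theory I: construction of Hodge theaters*, kurims manuscript (May 2020), §2,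
proof of Prop. 2.4 (i), p. 50 l. 40–42: "Since, by allowing `J` to vary, `Π^tp_X` (respectively, `Π̂_X`) may be
written as an inverse limit of the topological groups `Π^tp_X/Ker(J ↠ Π^tp_{𝔾_J})` (respectively,
`Π̂_X/Ker(Ĵ ↠ Π̂_{𝔾_J})`), we thus conclude that `γ` lies in `Π^tp_X`" ([IUTchI] Prop 2.4(i) p.50)
[claim: Mochizuki2012, status: disputed] (D-0012 claim key; series status DISPUTED — nothing of the series is asserted
here), over Mochizuki, *Semi-graphs of anabelioids*, Publ. RIMS **42** (2006), Def. 3.1 (i) p. 33 ("tempered":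
an inverse limit of surjections of countable discrete topological groups) and Ex. 3.10 pp. 44–45
[cite: MochizukiSemiAnbd2006, Def 3.1(i) p.33].

PROOF-ONLY companion (abc-iut cell, block F seat abc-iut-f-193, FACT-LIST rows F-2599/F-2600 = `Prop24i`/`Prop24ii`
AT THE NAMED INSTANCE `StableCurveTemperedData.ofSpecialFibre`; no definitions, no new `Prop` fact).  It is the
assertion-(i) twin of abc-iut-w4-d063's `StableCurveTemperedDataOfSpecialFibreQTowerComplete.lean` (p431978): there
the TEMPERED COMPLETENESS binder `hlim` of the (ii)-tower was proved from the interface axiom `IsTempered Π^temp_{X_K}`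
(`GroupLevelData.isTempered`) and the one reading `hadm` ("the admissible kernels `Ker(N_j ↠ π₁^temp(𝒢_j))` shrink
to `1`"), by the interpolation lemma `hlimOn_of_admKer_nhds_one`.  For assertion (i) the sub-DAG input
(INV) `Prop24Tower.DetectsTempered` of the level data `towerOfSpecialFibreTower` (abc-iut-L5-t11) was so far either a
RAW binder (`prop24i_ofSpecialFibre_byName`, p434631; CERT-L5 v0.6 (β) `hINV`, p442476) or reduced
(`detectsTempered_ofSpecialFibre`, `…TowerKernel`) to `hcof` + `hlim` + an extra level-injectivity binder `hNinj`.
HERE (INV) is PROVED from `hcof` + `hadm` alone: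

* `detectsTempered_ofSpecialFibre_of_admKer_nhds_one (hcof) (hadm)` — the argument of abc-iut-L5-t11's
  `Prop24Tower.detectsTempered_of_inverseLimit` run in the INDEX order of the tower (so that the kernel
  monotonicity is `admKerHat_antitone`, hypothesis-free, and `hNinj` is not needed): choose tempered
  representatives `t_i` with `ι(t_i)⁻¹ γ ∈ Ker(Ĵ_i ↠ Π̂_{𝔾_{J_i}}) = admKerHat_i` (`map_ker_pihat_eq_closure`) at the
  levels below `W` (an eventually-full index set, `levelJhat_antitone`); they are Cauchy for the `admKerHat` filtration;
  `hlimOn_of_admKer_nhds_one` interpolates them by one `s ∈ Π^temp_{X_K}`; then `ι(s)⁻¹ γ` lies in every level below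
  `W`, hence is `1` (`eq_one_of_forall_mem_level`, cofinality from `hcof`).
* `prop24i_ofSpecialFibre_byName_of_admKer_nhds_one` — abc-iut-L5-t11's `prop24i_ofSpecialFibre_byName` with `hINV`
  REPLACED by `hadm`;
* over L3's origin-data record `P : SpecialFibreTower.PiData X d S T` (`hcof := P.N_cofinal`, [SemiAnbd] Thm 3.7 (iii)
  at the finite fibres `:= compactInVerticialAt_of_piData`): `detectsTempered_ofPiData_of_admKer_nhds_one`,
  `prop24i_ofPiData_of_admKer_nhds_one`, and the joint capstone `prop24i_prop24ii_ofPiData_of_admKer_nhds_one`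
  (Prop. 2.4 (i) ∧ (ii) AS TYPED at the genuine datum from the per-level inputs `hstf` · `hA3` · `hspec` · `hadm` · `hLev`
  + verticial/node DATA — the law list of CERT-L5 v0.6 (β) with `hINV` gone; assertions (i) and (ii) now share `hadm`).

Typed ≠ discharged for `hadm`/`hstf`/`hA3`/`hspec`/`hLev` (GAP-LEDGER classes G-L5t11g6-1 and G-L5t11g6-3: readings of [SemiAnbd]
Ex. 3.10 that L3's `SpecialFibreTower` does not record); `P` is origin data asserted for no curve; nothing here
asserts that abc is proved or refuted, and nothing here bears on [IUTchIII] Cor. 3.12.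
-/

noncomputable section

namespace Literature.IUT.HodgeTheaters

namespace StableCurveTemperedData

namespace OfSpecialFibre

open _root_.Topology
open scoped Pointwise
open Literature.AnabelianGeometry.SemiGraphs Literature.AnabelianGeometry.SemiGraphs.ProfiniteSemiGraph

variable {p : ℕ} [Fact p.Prime] (X : TemperedCurve p) (d : X.GroupLevelData)
  (T : SpecialFibreTower X.DeltaTemp)
  (Sigma SigmaHat : Set ℕ) (hsub : Sigma ⊆ SigmaHat) (hne : Sigma.Nonempty)
  (hprime : ∀ q ∈ SigmaHat, q.Prime)
  (S : SpecialFibreData (X.toTemperedArithmeticGroup d)) (h36 : S.Gc.Prop36Hypotheses)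
  (hp : p ∉ Sigma) (TpH : Subgroup S.chart.G)
  (HatH : Subgroup (TemperedGraphGroupData.exists_completion_of_prop36 S.Gc h36 S.chart).choose)
  (hle : TpH.map (TemperedGraphGroupData.exists_completion_of_prop36 S.Gc h36
    S.chart).choose_spec.choose.toMonoidHom ≤ HatH)
  (cuspMeetsH : {x : X.Pt // X.IsCusp x} → Prop)

/-! ### (INV) for the (i)-tower from `IsTempered` + `hcof` + `hadm` -/

/-- **(INV) `DetectsTempered` at the genuine 𝔛-datum, PROVED from the cofinality of the levels (`hcof`) and "the
admissible kernels shrink to `1`" (`hadm`)** — the tempered completeness `hlim` of abc-iut-L5-t11's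
`detectsTempered_ofSpecialFibre` being supplied by abc-iut-w4-d063's interpolation `hlimOn_of_admKer_nhds_one`
(`IsTempered Π^temp_{X_K}`, [SemiAnbd] Def. 3.1 (i)), and the kernel monotonicity by `admKerHat_antitone` in the index
order (no `hNinj`).  Print: "by allowing `J` to vary, `Π^tp_X` … may be written as an inverse limit of the topological
groups `Π^tp_X/Ker(J ↠ Π^tp_{𝔾_J})` … we thus conclude that `γ` lies in `Π^tp_X`" (p. 50 l. 40–42).
([IUTchI] Prop 2.4(i) p.50) [claim: Mochizuki2012, status: disputed] -/
theorem detectsTempered_ofSpecialFibre_of_admKer_nhds_one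
    (hcof : ∀ U : Subgroup X.DeltaTemp, IsOpen (U : Set X.DeltaTemp) → U.Normal → U.FiniteIndex →
      ∃ i, T.N i ≤ U)
    (hadm : ∀ U ∈ 𝓝 (1 : ↥X.DeltaTemp), ∃ j, ((T.admKer j : Subgroup ↥X.DeltaTemp) : Set ↥X.DeltaTemp) ⊆ U) :
    (towerOfSpecialFibreTower X d T Sigma SigmaHat hsub hne hprime S h36 hp TpH HatH hle
      cuspMeetsH).DetectsTempered := by
  haveI : T2Space X.PiHat := X.isProfiniteCompletion_toHat.t2Space
  haveI : TotallyDisconnectedSpace X.PiHat := X.isProfiniteCompletion_toHat.totallyDisconnectedSpace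
  classical
  intro W hW γ hγ
  obtain ⟨i₀, hi₀⟩ := hW
  -- the kernel of `Ĵ_i ↠ Π̂_{𝔾_{J_i}}`, read in `Π_{X_K}`, IS `admKerHat_i`
  have hker : ∀ i : ℕ,
      ((((towerOfSpecialFibreTower X d T Sigma SigmaHat hsub hne hprime S h36 hp TpH HatH hle
          cuspMeetsH).πhat i).ker.map
        ((towerOfSpecialFibreTower X d T Sigma SigmaHat hsub hne hprime S h36 hp TpH HatH hle
          cuspMeetsH).Jhat i).subtype : Subgroup X.PiHat)) = admKerHat X T i :=
    fun i => map_ker_pihat_eq_closure X d T Sigma SigmaHat hsub hne hprime S h36 hp TpH HatH hle cuspMeetsH i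
  -- the levels below `W` contain every level `≥ i₀`
  have hJ : ∀ i : ℕ, @LE.le ℕ _ i₀ i →
      (towerOfSpecialFibreTower X d T Sigma SigmaHat hsub hne hprime S h36 hp TpH HatH hle
        cuspMeetsH).Jhat i ≤ W :=
    fun i hi => le_trans (levelJhat_antitone X T hi) hi₀
  -- tempered representatives `t_i` with `ι(t_i)⁻¹ γ ∈ admKerHat_i` at the levels below `W`
  have key : ∀ i : ℕ, ∃ t : X.PiTemp,
      (towerOfSpecialFibreTower X d T Sigma SigmaHat hsub hne hprime S h36 hp TpH HatH hle
          cuspMeetsH).Jhat i ≤ W →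
        (X.toHat t)⁻¹ * γ ∈ admKerHat X T i := by
    intro i
    by_cases hi : (towerOfSpecialFibreTower X d T Sigma SigmaHat hsub hne hprime S h36 hp TpH HatH hle
        cuspMeetsH).Jhat i ≤ W
    · obtain ⟨t, h, h1⟩ := hγ i hi
      refine ⟨t, fun _ => ?_⟩
      rw [← hker i]
      exact (towerOfSpecialFibreTower X d T Sigma SigmaHat hsub hne hprime S h36 hp TpH HatH hle
        cuspMeetsH).mem_kerHat_iff.mpr ⟨h, h1⟩
    · exact ⟨1, fun h => absurd h hi⟩
  choose t ht using key
  -- the family is Cauchy, along the levels below `W`, for the `admKerHat` filtration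
  have hcau : ∀ i ∈ {i : ℕ | (towerOfSpecialFibreTower X d T Sigma SigmaHat hsub hne hprime S h36 hp TpH HatH hle
        cuspMeetsH).Jhat i ≤ W},
      ∀ j ∈ {i : ℕ | (towerOfSpecialFibreTower X d T Sigma SigmaHat hsub hne hprime S h36 hp TpH HatH hle
        cuspMeetsH).Jhat i ≤ W},
        i ≤ j → X.toHat ((t i)⁻¹ * t j) ∈ admKerHat X T i := by
    intro i hi j hj hij
    have ha : (X.toHat (t i))⁻¹ * γ ∈ admKerHat X T i := ht i hi
    have hb : (X.toHat (t j))⁻¹ * γ ∈ admKerHat X T i := admKerHat_antitone X T hij (ht j hj)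
    have e : X.toHat ((t i)⁻¹ * t j) = ((X.toHat (t i))⁻¹ * γ) * ((X.toHat (t j))⁻¹ * γ)⁻¹ := by
      simp only [map_mul, map_inv, mul_inv_rev, inv_inv]
      group
    rw [e]
    exact Subgroup.mul_mem _ ha (Subgroup.inv_mem _ hb)
  obtain ⟨s, hs⟩ := hlimOn_of_admKer_nhds_one X T d hadm _ i₀ hJ t hcau
  -- `ι(s)⁻¹ γ` lies in every level below `W`
  have hδ : ∀ i : ℕ,
      (towerOfSpecialFibreTower X d T Sigma SigmaHat hsub hne hprime S h36 hp TpH HatH hle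
          cuspMeetsH).Jhat i ≤ W →
        (X.toHat s)⁻¹ * γ ∈ (towerOfSpecialFibreTower X d T Sigma SigmaHat hsub hne hprime S h36 hp TpH HatH hle
          cuspMeetsH).Jhat i := by
    intro i hi
    have e : (X.toHat s)⁻¹ * γ = X.toHat (s⁻¹ * t i) * ((X.toHat (t i))⁻¹ * γ) := by
      simp only [map_mul, map_inv]
      group
    have hmem : X.toHat (s⁻¹ * t i) * ((X.toHat (t i))⁻¹ * γ) ∈ admKerHat X T i :=
      Subgroup.mul_mem _ (hs i hi) (ht i hi)
    rw [← hker i] at hmem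
    rw [e]
    exact (towerOfSpecialFibreTower X d T Sigma SigmaHat hsub hne hprime S h36 hp TpH HatH hle
      cuspMeetsH).kerHat_le i hmem
  have hone := (towerOfSpecialFibreTower X d T Sigma SigmaHat hsub hne hprime S h36 hp TpH HatH hle
      cuspMeetsH).eq_one_of_forall_mem_level
    (ofSpecialFibre_deltaHatClosed X d Sigma SigmaHat hsub hne hprime S h36 hp TpH HatH hle cuspMeetsH)
    (towerOfSpecialFibreTower_levelsInDelta X d T Sigma SigmaHat hsub hne hprime S h36 hp TpH HatH hle cuspMeetsH)
    (towerOfSpecialFibreTower_levelsOpen X d T Sigma SigmaHat hsub hne hprime S h36 hp TpH HatH hle cuspMeetsH)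
    (towerOfSpecialFibreTower_levelsCofinal X d T Sigma SigmaHat hsub hne hprime S h36 hp TpH HatH hle
      cuspMeetsH hcof)
    ⟨i₀, hi₀⟩ hδ
  rw [inv_mul_eq_one] at hone
  exact ⟨s, hone⟩

/-! ### Prop. 2.4 (i) at the genuine datum with (INV) so discharged -/

/-- **[IUTchI] Prop. 2.4 (i) AS TYPED at the genuine 𝔛-data, the level Prop. 2.1's BY NAME and (INV) DISCHARGED**:
abc-iut-L5-t11's `prop24i_ofSpecialFibre_byName` with its binder `hINV : DetectsTempered` REPLACED by the reading
`hadm` ("the admissible kernels shrink to `1`") through `detectsTempered_ofSpecialFibre_of_admKer_nhds_one`.  Residual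
named inputs: `hcof`, "[Config] Rmk 1.2.2" (`hstf`), [SemiAnbd] Thm 3.7 (iii) at every level graph (`hCV`), verticial
families with node data and (A3) ([NodNon] Lem 1.9 (ii), `hA3`), the `p ∉ Σ` specialisation half (`hspec`), `hadm`.
([IUTchI] Prop 2.4(i) p.50) [claim: Mochizuki2012, status: disputed] -/
theorem prop24i_ofSpecialFibre_byName_of_admKer_nhds_one
    (hcof : ∀ U : Subgroup X.DeltaTemp, IsOpen (U : Set X.DeltaTemp) → U.Normal → U.FiniteIndex →
      ∃ i, T.N i ≤ U)
    (hstf : (ofSpecialFibre X d S h36 Sigma SigmaHat hsub hne hprime hp TpH HatH hle cuspMeetsH).StronglyTorsionFreeSigma)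
    (hCV : ∀ i, CompactInVerticialAt (T.Gc i))
    (Λv : ∀ i, (T.Gc i).graph.Vertex → Subgroup (T.chart i).G)
    (hΛv : ∀ i v, Λv i v ∈ verticialSubgroups (T.chart i) v)
    (E : ℕ → Type) (src tgt : ∀ i, E i → (T.Gc i).graph.Vertex) (c₁ c₂ : ∀ i, E i → (T.chart i).G)
    (hA3 : ∀ i (v w : (T.Gc i).graph.Vertex) (g h : (levelGraph X T Sigma SigmaHat hsub hne hprime i).Hat),
      MulAut.conj g • (Λv i v).map (levelGraph X T Sigma SigmaHat hsub hne hprime i).ι ⊓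
          MulAut.conj h • (Λv i w).map (levelGraph X T Sigma SigmaHat hsub hne hprime i).ι ≠ ⊥ →
        (v = w ∧ g⁻¹ * h ∈ (Λv i v).map (levelGraph X T Sigma SigmaHat hsub hne hprime i).ι) ∨
        ∃ (e : E i) (k : (levelGraph X T Sigma SigmaHat hsub hne hprime i).Hat),
          ∃ p ∈ (Λv i (src i e)).map (levelGraph X T Sigma SigmaHat hsub hne hprime i).ι,
          ∃ q ∈ (Λv i (tgt i e)).map (levelGraph X T Sigma SigmaHat hsub hne hprime i).ι,
            (src i e = v ∧ tgt i e = w ∧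
                g = k * (levelGraph X T Sigma SigmaHat hsub hne hprime i).ι (c₁ i e) * p ∧
                h = k * (levelGraph X T Sigma SigmaHat hsub hne hprime i).ι (c₂ i e) * q) ∨
            (src i e = w ∧ tgt i e = v ∧
                h = k * (levelGraph X T Sigma SigmaHat hsub hne hprime i).ι (c₁ i e) * p ∧
                g = k * (levelGraph X T Sigma SigmaHat hsub hne hprime i).ι (c₂ i e) * q))
    (hspec : (towerOfSpecialFibreTower X d T Sigma SigmaHat hsub hne hprime S h36 hp TpH HatH hle cuspMeetsH).SpecializationAb)
    (hadm : ∀ U ∈ 𝓝 (1 : ↥X.DeltaTemp), ∃ j, ((T.admKer j : Subgroup ↥X.DeltaTemp) : Set ↥X.DeltaTemp) ⊆ U) :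
    (ofSpecialFibre X d S h36 Sigma SigmaHat hsub hne hprime hp TpH HatH hle cuspMeetsH).Prop24i :=
  prop24i_ofSpecialFibre_byName X d T Sigma SigmaHat hsub hne hprime S h36 hp TpH HatH hle cuspMeetsH hcof hstf hCV
    Λv hΛv E src tgt c₁ c₂ hA3 hspec
    (detectsTempered_ofSpecialFibre_of_admKer_nhds_one X d T Sigma SigmaHat hsub hne hprime S h36 hp TpH HatH hle
      cuspMeetsH hcof hadm)

/-! ### Over L3's origin-data record `SpecialFibreTower.PiData` -/

section PiData

/-- **(INV) `DetectsTempered` at the genuine 𝔛-datum carrying its `Π`-equivariant structure `P`**, from the single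
reading `hadm`: the cofinality `hcof` IS the record field `P.N_cofinal`.
([IUTchI] Prop 2.4(i) p.50) [claim: Mochizuki2012, status: disputed] -/
theorem detectsTempered_ofPiData_of_admKer_nhds_one (P : SpecialFibreTower.PiData X d S T)
    (hadm : ∀ U ∈ 𝓝 (1 : ↥X.DeltaTemp), ∃ j, ((T.admKer j : Subgroup ↥X.DeltaTemp) : Set ↥X.DeltaTemp) ⊆ U) :
    (towerOfSpecialFibreTower X d T Sigma SigmaHat hsub hne hprime S h36 hp TpH HatH hle
      cuspMeetsH).DetectsTempered :=
  detectsTempered_ofSpecialFibre_of_admKer_nhds_one X d T Sigma SigmaHat hsub hne hprime S h36 hp TpH HatH hle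
    cuspMeetsH P.N_cofinal hadm

/-- **[IUTchI] Prop. 2.4 (i) AS TYPED at the genuine 𝔛-datum carrying `P`**, from the per-level printed inputs:
verticial families `Λv` (data, with `hΛv`), level node data `E/src/tgt/c₁/c₂`, the laws `hstf` ([Config] Rmk 1.2.2) ·
`hA3` ([AbsTopII] Prop 1.3 (iv) / [NodNon] Lem 1.9 (ii), level form) · `hspec` (the `p ∉ Σ` specialisation half) ·
`hadm` (the admissible kernels shrink to `1`); with `hcof := P.N_cofinal` and [SemiAnbd] Thm 3.7 (iii) at every (finite)
level fibre a THEOREM (`compactInVerticialAt_of_piData`, abc-iut-w4-d063).  Versus CERT-L5 v0.6 (β): `hINV` is GONE.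
([IUTchI] Prop 2.4(i) p.50) [claim: Mochizuki2012, status: disputed] -/
theorem prop24i_ofPiData_of_admKer_nhds_one (P : SpecialFibreTower.PiData X d S T)
    (hstf : (ofSpecialFibre X d S h36 Sigma SigmaHat hsub hne hprime hp TpH HatH hle cuspMeetsH).StronglyTorsionFreeSigma)
    (Λv : ∀ i, (T.Gc i).graph.Vertex → Subgroup (T.chart i).G)
    (hΛv : ∀ i v, Λv i v ∈ verticialSubgroups (T.chart i) v)
    (E : ℕ → Type) (src tgt : ∀ i, E i → (T.Gc i).graph.Vertex) (c₁ c₂ : ∀ i, E i → (T.chart i).G)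
    (hA3 : ∀ i (v w : (T.Gc i).graph.Vertex) (g h : (levelGraph X T Sigma SigmaHat hsub hne hprime i).Hat),
      MulAut.conj g • (Λv i v).map (levelGraph X T Sigma SigmaHat hsub hne hprime i).ι ⊓
          MulAut.conj h • (Λv i w).map (levelGraph X T Sigma SigmaHat hsub hne hprime i).ι ≠ ⊥ →
        (v = w ∧ g⁻¹ * h ∈ (Λv i v).map (levelGraph X T Sigma SigmaHat hsub hne hprime i).ι) ∨
        ∃ (e : E i) (k : (levelGraph X T Sigma SigmaHat hsub hne hprime i).Hat),
          ∃ p ∈ (Λv i (src i e)).map (levelGraph X T Sigma SigmaHat hsub hne hprime i).ι,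
          ∃ q ∈ (Λv i (tgt i e)).map (levelGraph X T Sigma SigmaHat hsub hne hprime i).ι,
            (src i e = v ∧ tgt i e = w ∧
                g = k * (levelGraph X T Sigma SigmaHat hsub hne hprime i).ι (c₁ i e) * p ∧
                h = k * (levelGraph X T Sigma SigmaHat hsub hne hprime i).ι (c₂ i e) * q) ∨
            (src i e = w ∧ tgt i e = v ∧
                h = k * (levelGraph X T Sigma SigmaHat hsub hne hprime i).ι (c₁ i e) * p ∧
                g = k * (levelGraph X T Sigma SigmaHat hsub hne hprime i).ι (c₂ i e) * q))
    (hspec : (towerOfSpecialFibreTower X d T Sigma SigmaHat hsub hne hprime S h36 hp TpH HatH hle cuspMeetsH).SpecializationAb)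
    (hadm : ∀ U ∈ 𝓝 (1 : ↥X.DeltaTemp), ∃ j, ((T.admKer j : Subgroup ↥X.DeltaTemp) : Set ↥X.DeltaTemp) ⊆ U) :
    (ofSpecialFibre X d S h36 Sigma SigmaHat hsub hne hprime hp TpH HatH hle cuspMeetsH).Prop24i :=
  prop24i_ofSpecialFibre_byName_of_admKer_nhds_one X d T Sigma SigmaHat hsub hne hprime S h36 hp TpH HatH hle
    cuspMeetsH P.N_cofinal hstf (compactInVerticialAt_of_piData P) Λv hΛv E src tgt c₁ c₂ hA3 hspec hadm

/-- **[IUTchI] Prop. 2.4 (i) ∧ (ii) AS TYPED at the genuine 𝔛-datum carrying `P` — the Prop-2.4 block of CERT-L5 v0.6 (β)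
(`layer5_held_sec2_v6_prop24_piData`, p442476) with `hINV` DISCHARGED**: laws `hstf` · `hA3` · `hspec` · `hadm` · `hLev`
(assertions (i) and (ii) now share the single reading `hadm`), data `Λv` (with `hΛv`), `E/src/tgt/c₁/c₂`; assertion (ii)
is abc-iut-w4-d063's `prop24ii_ofPiData` verbatim.  Every hypothesis is a primitive printed input or a
prerequisite-paper statement BY NAME; no node statement of [IUTchI] is assumed; `P` is origin data asserted for no curve.
([IUTchI] Prop 2.4(i)(ii) pp.50-51) [claim: Mochizuki2012, status: disputed] -/
theorem prop24i_prop24ii_ofPiData_of_admKer_nhds_one (P : SpecialFibreTower.PiData X d S T)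
    (hstf : (ofSpecialFibre X d S h36 Sigma SigmaHat hsub hne hprime hp TpH HatH hle cuspMeetsH).StronglyTorsionFreeSigma)
    (Λv : ∀ i, (T.Gc i).graph.Vertex → Subgroup (T.chart i).G)
    (hΛv : ∀ i v, Λv i v ∈ verticialSubgroups (T.chart i) v)
    (E : ℕ → Type) (src tgt : ∀ i, E i → (T.Gc i).graph.Vertex) (c₁ c₂ : ∀ i, E i → (T.chart i).G)
    (hA3 : ∀ i (v w : (T.Gc i).graph.Vertex) (g h : (levelGraph X T Sigma SigmaHat hsub hne hprime i).Hat),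
      MulAut.conj g • (Λv i v).map (levelGraph X T Sigma SigmaHat hsub hne hprime i).ι ⊓
          MulAut.conj h • (Λv i w).map (levelGraph X T Sigma SigmaHat hsub hne hprime i).ι ≠ ⊥ →
        (v = w ∧ g⁻¹ * h ∈ (Λv i v).map (levelGraph X T Sigma SigmaHat hsub hne hprime i).ι) ∨
        ∃ (e : E i) (k : (levelGraph X T Sigma SigmaHat hsub hne hprime i).Hat),
          ∃ p ∈ (Λv i (src i e)).map (levelGraph X T Sigma SigmaHat hsub hne hprime i).ι,
          ∃ q ∈ (Λv i (tgt i e)).map (levelGraph X T Sigma SigmaHat hsub hne hprime i).ι,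
            (src i e = v ∧ tgt i e = w ∧
                g = k * (levelGraph X T Sigma SigmaHat hsub hne hprime i).ι (c₁ i e) * p ∧
                h = k * (levelGraph X T Sigma SigmaHat hsub hne hprime i).ι (c₂ i e) * q) ∨
            (src i e = w ∧ tgt i e = v ∧
                h = k * (levelGraph X T Sigma SigmaHat hsub hne hprime i).ι (c₁ i e) * p ∧
                g = k * (levelGraph X T Sigma SigmaHat hsub hne hprime i).ι (c₂ i e) * q))
    (hspec : (towerOfSpecialFibreTower X d T Sigma SigmaHat hsub hne hprime S h36 hp TpH HatH hle cuspMeetsH).SpecializationAb)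
    (hadm : ∀ U ∈ 𝓝 (1 : ↥X.DeltaTemp), ∃ j, ((T.admKer j : Subgroup ↥X.DeltaTemp) : Set ↥X.DeltaTemp) ⊆ U)
    (hLev : (qTowerOfSpecialFibreTower X T d S h36 Sigma SigmaHat hsub hne hprime hp TpH HatH hle cuspMeetsH
      P.admKer_normal_pi).LevelObservation) :
    (ofSpecialFibre X d S h36 Sigma SigmaHat hsub hne hprime hp TpH HatH hle cuspMeetsH).Prop24i ∧
      (ofSpecialFibre X d S h36 Sigma SigmaHat hsub hne hprime hp TpH HatH hle cuspMeetsH).Prop24ii :=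
  ⟨prop24i_ofPiData_of_admKer_nhds_one X d T Sigma SigmaHat hsub hne hprime S h36 hp TpH HatH hle cuspMeetsH P hstf
      Λv hΛv E src tgt c₁ c₂ hA3 hspec hadm,
    prop24ii_ofPiData X T d S h36 Sigma SigmaHat hsub hne hprime hp TpH HatH hle cuspMeetsH P hadm hLev⟩

end PiData

/-! ### The reading `hadm` in the compact regime (non-vacuity of the remaining structural law) -/

section Compact

/-- An open subgroup of a compact topological group has finite index (the quotient is compact and discrete);
local copy of a classical fact (the tree has it in several files not imported here). [folklore] -/
private theorem finiteIndex_of_isOpen_of_compactSpace_aux {G : Type*} [Group G] [TopologicalSpace G]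
    [IsTopologicalGroup G] [CompactSpace G] (H : Subgroup G) (hH : IsOpen (H : Set G)) : H.FiniteIndex := by
  haveI : DiscreteTopology (G ⧸ H) := QuotientGroup.discreteTopology hH
  haveI : Finite (G ⧸ H) := finite_of_compact_of_discrete
  exact Subgroup.finiteIndex_of_finite_quotient

/-- **The reading `hadm` ("the admissible kernels shrink to `1`") is a THEOREM in the compact regime**: if
`Π^temp_{X_K}` is compact, then `Δ^temp_X` (closed in it, Hausdorff and totally disconnected through the injection into
`Π_{X_K}`) is profinite, so every neighbourhood of `1` contains an open normal subgroup of finite index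
(`ProfiniteGrp.exist_openNormalSubgroup_sub_open_nhds_of_one`), which contains some `N_j` by the record's cofinality
`P.N_cofinal`, hence `admKer_j ⊆ N_j`.  Non-vacuity evidence for the one structural law left in
`prop24i_prop24ii_ofPiData_of_admKer_nhds_one` at the tree's (profinite) inhabitants of `PiData`
(`SpecialFibreTower.PiData.exists_inhabited`, abc-iut-L3-t2); content-free as to André's `π₁^temp` (HONEST LIMIT: the
compact regime is exactly where Prop. 2.4 is trivial, abc-iut-f-193 gen 2 p440842).
[cite: MochizukiSemiAnbd2006, Ex 3.10 p.44] -/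
theorem admKer_nhds_one_of_compactSpace [CompactSpace X.PiTemp] (P : SpecialFibreTower.PiData X d S T) :
    ∀ U ∈ 𝓝 (1 : ↥X.DeltaTemp), ∃ j, ((T.admKer j : Subgroup ↥X.DeltaTemp) : Set ↥X.DeltaTemp) ⊆ U := by
  haveI : T2Space X.PiHat := X.isProfiniteCompletion_toHat.t2Space
  haveI : TotallyDisconnectedSpace X.PiHat := X.isProfiniteCompletion_toHat.totallyDisconnectedSpace
  haveI : T2Space X.PiTemp := T2Space.of_injective_continuous X.toHat_injective X.toHat.continuous
  haveI : TotallyDisconnectedSpace X.PiTemp :=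
    ⟨fun s _ hs => Set.subsingleton_of_image X.toHat_injective s
      ((hs.image _ X.toHat.continuous.continuousOn).subsingleton)⟩
  -- `Δ^temp = Ker(Π^temp → G_{ℚ_p})` is closed (`G_{ℚ_p}` is Hausdorff), hence compact
  have hΔclosed : IsClosed (X.DeltaTemp : Set X.PiTemp) := by
    haveI : IsGalois ℚ_[p] (AlgebraicClosure ℚ_[p]) := {}
    haveI : T2Space (GQp p) := krullTopology_t2
    have h : (X.DeltaTemp : Set X.PiTemp) = X.aug ⁻¹' {1} := by
      ext x
      simp [TemperedCurve.DeltaTemp]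
    rw [h]
    exact isClosed_singleton.preimage X.aug.continuous
  haveI : CompactSpace X.DeltaTemp := isCompact_iff_compactSpace.mp hΔclosed.isCompact
  intro U hU
  obtain ⟨V, hVU, hVopen, h1V⟩ := mem_nhds_iff.mp hU
  obtain ⟨N, hN⟩ := ProfiniteGrp.exist_openNormalSubgroup_sub_open_nhds_of_one hVopen h1V
  haveI : N.toSubgroup.FiniteIndex := finiteIndex_of_isOpen_of_compactSpace_aux N.toSubgroup N.isOpen'
  haveI : N.toSubgroup.Normal := N.isNormal'
  obtain ⟨j, hj⟩ := P.N_cofinal N.toSubgroup N.isOpen' inferInstance inferInstance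
  exact ⟨j, fun x hx => hVU (hN (hj (T.admKer_le j hx)))⟩

/-- **(INV) `DetectsTempered` UNCONDITIONALLY in the compact regime** at the genuine 𝔛-datum carrying `P` — from
`admKer_nhds_one_of_compactSpace`; non-vacuity instance of `detectsTempered_ofPiData_of_admKer_nhds_one`.
([IUTchI] Prop 2.4(i) p.50) [claim: Mochizuki2012, status: disputed] -/
theorem detectsTempered_ofPiData_of_compactSpace [CompactSpace X.PiTemp] (P : SpecialFibreTower.PiData X d S T) :
    (towerOfSpecialFibreTower X d T Sigma SigmaHat hsub hne hprime S h36 hp TpH HatH hle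
      cuspMeetsH).DetectsTempered :=
  detectsTempered_ofPiData_of_admKer_nhds_one X d T Sigma SigmaHat hsub hne hprime S h36 hp TpH HatH hle cuspMeetsH P
    (admKer_nhds_one_of_compactSpace X d T S P)

end Compact

end OfSpecialFibre

end StableCurveTemperedData

end Literature.IUT.HodgeTheaters

end
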